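import Summits.NavierStokesRegularity.NavierStokesRegularity.Theorems.TypeICertificateLadderRungReynoldsOneTaoCover
import HarnessLib

/-!
# Route `GaldiLiouvilleGate`, crux `RecordZoomAncient` (stmt-NavierStokesRegularity-0894),
  line `registered` (birth skeleton, reshape r2) — stub `stub_taoRep` (Tao-class representation)

**Statement.** A classical solution `(u, p)` of the unforced Navier–Stokes system (viscosity
`ν > 0`) on `ℝ³ × [0, T)` which is Leray–Hopf on `[0, T]` from its rapidly decaying datum `u 0`
is, on every closed sub-slab `[0, T']`, `0 < T' < T`, a solution in Tao's smooth `H¹` class from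
`u 0` with some pressure `P`: `IsTaoSolutionOn T' ν (u 0) u P` (classical on the closed slab, all
`L²` Sobolev norms of `u`, of `∂ₜu` within `[0, T']` and of `P` bounded, `u ∈ C([0, T']; L²)`).

**Proof.** Two proved tree theorems. (a) On `[0, T']` the solution is classical
(`IsClassicalNSSolutionOn.mono`, `[0, T'] ⊆ [0, T)` is a set of unique differentiability) with
`sup_t ‖u(t)‖²_{L²} ≤ 2 E(u 0)` (Leray–Hopf energy inequality,
`IsLerayHopfOn.lintegral_enorm_sq_le`), so Tao 2013, Cor. 11.1 — the tree theorem
`tao2011_hasBoundedSobolevNormsOn_holds` — bounds all `L²` Sobolev norms of `u` on `[0, T']`.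
(b) A classical solution with bounded Sobolev norms on a closed slab is the velocity of a
Tao-class solution from its initial slice
(`RungReynoldsOne.exists_isTaoSolutionOn_of_hasBoundedSobolevNormsOn`,
`TypeICertificateLadderRungReynoldsOneTaoCover.lean`: continuation with Tao's local theorem
`tao2011_smooth_local_existence_holds`, uniqueness in the Sobolev class, gluing
`IsTaoSolutionOn.glue`; the Tao-class pressure serves).

Sources: T. Tao, *Localisation and compactness properties of the Navier–Stokes global
regularity problem*, Anal. PDE 6 (2013), Thm. 5.4, Cor. 11.1; J. Leray, Acta Math. 63 (1934),
§32 (energy inequality); P. G. Lemarié-Rieusset, *The Navier–Stokes Problem in the 21st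
Century* (2016), Thm. 7.2 (restart step).
-/

noncomputable section

open Set MeasureTheory Filter Topology Function Metric
open scoped ENNReal NNReal
open Literature.Analysis.FluidPDE

namespace Summit.NavierStokesRegularity.NavierStokesRegularity.Theorems.RecordZoomAncient.Birth

-- the problem-side namespace `Summit.NavierStokesRegularity.NavierStokesRegularity.…` (summit =
-- problem for this single-problem summit) duplicates `NavierStokesRegularity` by design
set_option linter.dupNamespace false

/-- **stub 0 — `stub_taoRep` (Tao-class representation of the given classical solution).** A
classical solution of the unforced Navier–Stokes system on `ℝ³ × [0, T)` which is Leray–Hopf on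
`[0, T]` from its rapidly decaying datum `u 0` is, on every closed sub-slab `[0, T']`,
`0 < T' < T`, a Tao-class solution from `u 0` with some pressure `P`:
`IsTaoSolutionOn T' ν (u 0) u P`. Proof: on `[0, T']` the solution is classical with energy
bounded by `2 E(u 0)` (`IsLerayHopfOn.lintegral_enorm_sq_le`), so all `L²` Sobolev norms of `u`
are bounded there (Tao 2013, Cor. 11.1, `tao2011_hasBoundedSobolevNormsOn_holds`), and a
classical solution with bounded Sobolev norms on a closed slab carries a Tao-class pressure
(`RungReynoldsOne.exists_isTaoSolutionOn_of_hasBoundedSobolevNormsOn`). -/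
theorem stub_taoRep :
    ∀ (ν T : ℝ), 0 < ν → 0 < T →
      ∀ (u : ℝ → EuclideanSpace ℝ (Fin 3) → EuclideanSpace ℝ (Fin 3))
        (p : ℝ → EuclideanSpace ℝ (Fin 3) → ℝ),
        IsClassicalNSSolutionOn (Set.Ico 0 T) ν 0 u p → IsLerayHopfOn T ν 0 (u 0) u →
        HasRapidSpatialDecay (u 0) →
        ∀ T' ∈ Set.Ioo 0 T, ∃ P : ℝ → EuclideanSpace ℝ (Fin 3) → ℝ,
          IsTaoSolutionOn T' ν (u 0) u P := by
  intro ν T hν _hT u p hsol hLH hdec T' hT'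
  -- (a) classical on the closed sub-slab, finite energy, hence bounded Sobolev norms
  have hsolc : IsClassicalNSSolutionOn (Icc 0 T') ν 0 u p :=
    hsol.mono (Icc_subset_Ico_right hT'.2) (uniqueDiffOn_Icc hT'.1)
  have hE : ∃ C : ℝ≥0, ∀ t ∈ Icc 0 T', ∫⁻ x, ‖u t x‖ₑ ^ 2 ≤ C :=
    ⟨(2 * VectorCalculus.kineticEnergy (u 0)).toNNReal, fun t ht =>
      hLH.lintegral_enorm_sq_le hν.le ⟨ht.1, ht.2.trans hT'.2.le⟩⟩
  have hB : HasBoundedSobolevNormsOn (Icc 0 T') u :=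
    tao2011_hasBoundedSobolevNormsOn_holds hν hT'.1 hsolc hE hdec
  -- (b) the Tao-class pressure
  exact RungReynoldsOne.exists_isTaoSolutionOn_of_hasBoundedSobolevNormsOn hν hT'.1 hsolc hB

end Summit.NavierStokesRegularity.NavierStokesRegularity.Theorems.RecordZoomAncient.Birth

end
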